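import Summits.BirchSwinnertonDyer.BirchSwinnertonDyer.Theorems.ManinLocalTwoThreeAtkinLehnerCuspFiftySix
import Summits.BirchSwinnertonDyer.BirchSwinnertonDyer.Theorems.ManinLocalTwoThreeEtaLimitDerivFiftySix
import HarnessLib

/-!
# The `η`-identities of `X₀(56) → 56a1` EXACTLY — `(V−U)² = U³ − 3U² + 4U`, `U′ = −2πi(P − Q)·2(V − U)` — and (S2)₅₆ₐ: `Λ(P − Q) ⊆ Λ(−4, −8)`,
# the Néron lattice shape of `56a1 = [0, 0, 0, 1, 2]`

Cell bsd-f2-manin, route `ManinLocalTwoThree` (crux C2 `ManinOddAtFour`, stmt-22967: `2² ∣ 56`), prover seat p2 gen 28.  Objects: `U = x + 1`,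
`V = y + x + 1` on `56a1 : y² = x³ + x + 2` (`EtaMonomialsFiftySix`), `φ = P − Q` the newform `56a` (`NewformPinningFiftySix`).  Both `U` and `V`
have their poles at the two cusps `∞` and `1/8 = W₇∞` of `X₀(56)`; the second cusp is handled by the ATKIN–LEHNER `η`-PERMUTATION device
(`AtkinLehnerEtaFiftySix`: `U∘A₀ = U∘β⁻¹`, `V∘A₀ = V∘β⁻¹`, `(P−Q)|A₀ = (P−Q)∘β⁻¹/7`, `β⁻¹σ = (σ+1)/7`), the six others by Ligozat
(`AtkinLehnerCuspFiftySix`), so only `q`-expansions AT `∞` enter ((T3)₅₆, (T1)₅₆ of `EtaLimits(Deriv)FiftySix`):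

* §1 **(I1)₅₆ₐ `(V − U)² = U³ − 3U² + 4U` on `ℍ`** — by WEIGHT ZERO: the difference is a holomorphic `Γ₀(56)`-invariant function bounded at
  every cusp and `→ 0` at `∞`, hence a constant (`ModularForm.eq_const_of_weight_zero`), hence `0`;
* §2 **(I2a)₅₆ₐ `U′ = −2πi(P − Q)·2(V − U)` on `ℍ`** — `(2πi)⁻¹U′ + (P−Q)·2(V−U)` is a cusp form of weight `2` on `Γ₀(56)` (zero at `1/8` by
  `W₇`, at the other cusps by Ligozat) with `S/q¹⁰ → 0`, hence `0` by the cuspidal Sturm bound `⌊2·96/12⌋ + 1 = 17 < 10 + 8`;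
* §3 **(S2)₅₆ₐ**: with `X = U − 1`, `(X′)² = (2πi(P−Q))²(4X³ + 4X + 8)`, so `Λ(P − Q) ⊆ Λ(L₁)` for the period pair with `g₂ = −4 = c₄/12`,
  `g₃ = −8 = c₆/216` (`56a1`: `c₄ = −48`, `c₆ = −1728`) — the analytic bridge `periodLattice_le_of_deriv_sq`.

No definition, no named fact, no sorry; nothing here proves C2, Manin's conjecture or BSD. [cite: Ligozat1975, Ch. 3–4]
[cite: CremonaAlgorithms1997, Table 1 (56a1), §2.10] [cite: DiamondShurman2005, §1.2, Thm. 3.5.1]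
-/

set_option autoImplicit false
-- lint-debt: the directory name repeats the summit name (sibling precedent `ManinLocalTwoThreeEtaIdentitiesForty.lean`)
set_option linter.dupNamespace false

noncomputable section

open Complex Filter Topology Set Function Asymptotics
open UpperHalfPlane hiding I
open scoped Real Topology Manifold MatrixGroups ModularForm
open ModularForm CongruenceSubgroup
open Literature.NumberTheory.ModularForms
open Literature.NumberTheory.EllipticCurves Literature.NumberTheory.EllipticCurves.ModularForms

namespace Summit.BirchSwinnertonDyer.BirchSwinnertonDyer.Theorems.ManinLocalTwoThree.EtaIdentitiesFiftySix

open CuspToolkit AnalyticBridge EtaIdentityReductionThirtySix EtaIdentityReductionFortyEight AtkinLehnerEtaFiftySix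
  AtkinLehnerCuspFiftySix NewformsFiftySix

/-- Shorthand hygiene: the exponent vectors of `U`, `V`, `P`, `Q` (local notation-free abbreviations are avoided; we spell them out). -/
theorem two_sq_dvd_fiftySix : 2 ^ 2 ∣ 56 := ⟨14, by norm_num⟩

/-! ## §1 (I1)₅₆ₐ: `(V − U)² = U³ − 3U² + 4U`, exactly, by weight zero -/

/-- **(I1)₅₆ₐ: `(V − U)² = U³ − 3U² + 4U` on `ℍ`** (`56a1: y² = x³ + x + 2` with `x = U − 1`, `y = V − U`).  The difference is a weight-`0` modular form
on `Γ₀(56)` (holomorphic, invariant; bounded at the cusps with `8 ∤ c` by Ligozat, at the class of `1/8` by `W₇`, and `→ 0` at `∞` by (T3)₅₆), hence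
constant, hence `0`. [cite: Ligozat1975, Ch. 3] [cite: CremonaAlgorithms1997, Table 1 (56a1)] -/
theorem cubic56 (τ : ℍ) :
    (etaQuotient 56 (expFn [(1, -1), (2, 2), (4, 1), (7, -1), (8, -2), (14, 2), (28, 1), (56, -2)]) τ
      - etaQuotient 56 (expFn [(2, -1), (4, 3), (8, -2), (14, -1), (28, 3), (56, -2)]) τ) ^ 2
    = etaQuotient 56 (expFn [(2, -1), (4, 3), (8, -2), (14, -1), (28, 3), (56, -2)]) τ ^ 3
      - 3 * etaQuotient 56 (expFn [(2, -1), (4, 3), (8, -2), (14, -1), (28, 3), (56, -2)]) τ ^ 2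
      + 4 * etaQuotient 56 (expFn [(2, -1), (4, 3), (8, -2), (14, -1), (28, 3), (56, -2)]) τ := by
  set U : ℍ → ℂ := etaQuotient 56 (expFn [(2, -1), (4, 3), (8, -2), (14, -1), (28, 3), (56, -2)]) with hU
  set V : ℍ → ℂ := etaQuotient 56 (expFn [(1, -1), (2, 2), (4, 1), (7, -1), (8, -2), (14, 2), (28, 1), (56, -2)]) with hV
  set F : ℍ → ℂ := fun σ ↦ (V σ - U σ) ^ 2 - (U σ ^ 3 - 3 * U σ ^ 2 + 4 * U σ) with hF
  have hF0 : Tendsto F atImInfty (𝓝 0) := EtaLimitsFiftySix.tendsto_T3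
  have hFsmul : ∀ γ : SL(2, ℤ), γ ∈ Gamma0 56 → ∀ σ : ℍ, F (γ • σ) = F σ := fun γ hγ σ ↦ by
    simp only [hF, hU, hV, U_smul γ hγ σ, V_smul γ hγ σ]
  have hslash0 : ∀ γ : SL(2, ℤ), F ∣[(0 : ℤ)] γ = fun σ ↦ F (γ • σ) := fun γ ↦ by
    funext σ
    rw [SL_slash_apply, neg_zero, zpow_zero, mul_one]
  have hFslash : ∀ γ : SL(2, ℤ), γ ∈ Gamma0 56 → F ∣[(0 : ℤ)] γ = F := fun γ hγ ↦ by
    rw [hslash0 γ]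
    funext σ
    exact hFsmul γ hγ σ
  have hUmd : MDifferentiable 𝓘(ℂ) 𝓘(ℂ) U := mdifferentiable_etaQuotient 56 _
  have hVmd : MDifferentiable 𝓘(ℂ) 𝓘(ℂ) V := mdifferentiable_etaQuotient 56 _
  have hFmd : MDifferentiable 𝓘(ℂ) 𝓘(ℂ) F := by
    have h := ((hVmd.sub hUmd).pow 2).sub (((hUmd.pow 3).sub ((hUmd.pow 2).const_smul (3 : ℂ))).add (hUmd.const_smul (4 : ℂ)))
    rw [show F = (V - U) ^ 2 - ((U ^ 3 - (3 : ℂ) • U ^ 2) + (4 : ℂ) • U) from by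
      funext σ; simp only [hF, Pi.add_apply, Pi.sub_apply, Pi.pow_apply, Pi.smul_apply, smul_eq_mul]]
    exact h
  -- at the class of the cusp `1/8`: `F(A₀σ) = F((σ+1)/7)`
  have hA₀ : ∀ A₀ : SL(2, ℤ), A₀ 0 0 = 1 → A₀ 0 1 = 0 → A₀ 1 0 = 8 → A₀ 1 1 = 1 → IsBoundedAtImInfty (F ∣[(0 : ℤ)] A₀) := by
    intro A₀ h00 h01 h10 h11
    rw [hslash0 A₀]
    have hfun : (fun σ : ℍ ↦ F (A₀ • σ)) = fun σ : ℍ ↦ F (affPt 1 1 7 one_pos (by norm_num) σ) := by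
      funext σ
      simp only [hF, hU, hV, U_A0_smul A₀ h00 h01 h10 h11 σ, V_A0_smul A₀ h00 h01 h10 h11 σ]
    rw [hfun]
    exact isBoundedAtImInfty_comp_affPt (Filter.ZeroAtFilter.boundedAtFilter hF0)
  have hFbdd : ∀ γ : SL(2, ℤ), IsBoundedAtImInfty (F ∣[(0 : ℤ)] γ) := by
    intro γ
    by_cases hγ : γ ∈ Gamma0 56
    · rw [hFslash γ hγ]
      exact Filter.ZeroAtFilter.boundedAtFilter hF0
    · by_cases h8 : (8 : ℤ) ∣ γ 1 0
      · exact isBoundedAtImInfty_slash_of_cusp_eighth F 0 hFslash hA₀ h8 hγ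
      · rw [hslash0 γ]
        have hUb : IsBoundedAtImInfty (fun τ : ℍ ↦ U (γ • τ)) := isBoundedAtImInfty_U_smul h8
        have hVb : IsBoundedAtImInfty (fun τ : ℍ ↦ V (γ • τ)) := isBoundedAtImInfty_V_smul h8
        have hVU : IsBoundedAtImInfty (fun τ : ℍ ↦ V (γ • τ) - U (γ • τ)) := hVb.sub hUb
        have hU2 : IsBoundedAtImInfty (fun τ : ℍ ↦ U (γ • τ) * U (γ • τ)) := hUb.mul hUb
        have hU3 : IsBoundedAtImInfty (fun τ : ℍ ↦ U (γ • τ) * U (γ • τ) * U (γ • τ)) := hU2.mul hUb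
        have hsq : IsBoundedAtImInfty (fun τ : ℍ ↦ (V (γ • τ) - U (γ • τ)) * (V (γ • τ) - U (γ • τ))) := hVU.mul hVU
        exact (hsq.sub ((hU3.sub (hU2.const_mul_left 3)).add (hUb.const_mul_left 4))).congr_left
          fun σ ↦ by simp only [hF]; ring
  let Fm : ModularForm (Gamma0 56) 0 :=
    { toFun := F
      slash_action_eq' := fun A hA ↦ by
        obtain ⟨γ, hγ, rfl⟩ := hA
        exact hFslash γ hγ
      holo' := hFmd
      bdd_at_cusps' := fun {c} hc ↦ by
        rw [Subgroup.IsArithmetic.isCusp_iff_isCusp_SL2Z] at hc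
        rw [OnePoint.isBoundedAt_iff_forall_SL2Z hc]
        intro γ _
        exact hFbdd γ }
  obtain ⟨c, hc⟩ := ModularForm.eq_const_of_weight_zero Fm
  have hc' : F = Function.const ℍ c := hc
  have hc0 : c = 0 := by
    rw [hc'] at hF0
    exact tendsto_const_nhds_iff.mp hF0
  have hFτ : F τ = 0 := by rw [hc', hc0]; rfl
  have h' : (V τ - U τ) ^ 2 - (U τ ^ 3 - 3 * U τ ^ 2 + 4 * U τ) = 0 := hFτ
  linear_combination h'

/-- Non-degeneracy on `X = U − 1`: `4X³ + 4X + 8 = 4(U³ − 3U² + 4U)` is not identically `0` (else `(Uq²)³ → 1` and `→ 0`). [folklore] -/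
theorem exists_X_nondegenerate :
    ∃ τ₀ : ℍ, 4 * (etaQuotient 56 (expFn [(2, -1), (4, 3), (8, -2), (14, -1), (28, 3), (56, -2)]) τ₀ - 1) ^ 3
      - (-4) * (etaQuotient 56 (expFn [(2, -1), (4, 3), (8, -2), (14, -1), (28, 3), (56, -2)]) τ₀ - 1) - (-8) ≠ 0 := by
  by_contra hne
  push Not at hne
  set U : ℍ → ℂ := etaQuotient 56 (expFn [(2, -1), (4, 3), (8, -2), (14, -1), (28, 3), (56, -2)]) with hU
  have hx3 : ∀ τ : ℍ, U τ ^ 3 = 3 * U τ ^ 2 - 4 * U τ := fun τ ↦ by linear_combination (1 / 4 : ℂ) * hne τ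
  have hq := tendsto_qParam_zpow_atImInfty (m := 2) (by norm_num)
  have hUq : Tendsto (fun τ : ℍ ↦ U τ * Function.Periodic.qParam 1 (τ : ℂ) ^ (2 : ℤ)) atImInfty (𝓝 1) := by
    have h := tendsto_etaQuotient_div_qParam_zpow 56 (expFn [(2, -1), (4, 3), (8, -2), (14, -1), (28, 3), (56, -2)]) (-2) (by decide)
    refine h.congr fun τ ↦ ?_
    rw [hU, zpow_neg, div_inv_eq_mul]
  have h1 : Tendsto (fun τ : ℍ ↦ (U τ * Function.Periodic.qParam 1 (τ : ℂ) ^ (2 : ℤ)) ^ 3) atImInfty (𝓝 1) := by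
    simpa using hUq.pow 3
  have h2 : Tendsto (fun τ : ℍ ↦ (U τ * Function.Periodic.qParam 1 (τ : ℂ) ^ (2 : ℤ)) ^ 3) atImInfty (𝓝 0) := by
    have h := (((hUq.pow 2).mul hq).const_mul 3).sub ((((hUq.const_mul 4).mul hq).mul hq))
    simp only [one_pow, mul_zero, sub_zero] at h
    refine h.congr fun τ ↦ ?_
    rw [mul_pow _ _ 3, hx3]
    ring
  exact one_ne_zero (tendsto_nhds_unique h1 h2)

/-! ## §2 (I2a)₅₆ₐ: `U′ = −2πi(P − Q)·2(V − U)`, exactly, by the cuspidal Sturm bound -/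

section Phi

variable (φ : CuspForm (Gamma0 56) 2)
  (hφ : ⇑φ = fun τ ↦ etaQuotient 56 (expFn [(2, -1), (4, 3), (14, 3), (28, -1)]) τ
      - etaQuotient 56 (expFn [(2, 3), (4, -1), (14, -1), (28, 3)]) τ)
include hφ

/-- `(P − Q)|₂A₀ = (P − Q)∘β⁻¹/7` for `A₀ = (1 0; 8 1)`: the newform `56a` has `W₇`-sign `+1`. [cite: AtkinLehner1970, Thm. 3] -/
theorem phi_slash_A0 (A₀ : SL(2, ℤ)) (h00 : A₀ 0 0 = 1) (h01 : A₀ 0 1 = 0) (h10 : A₀ 1 0 = 8) (h11 : A₀ 1 1 = 1) (σ : ℍ) :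
    (⇑φ ∣[(2 : ℤ)] A₀) σ = (1 / 7 : ℂ) * φ (affPt 1 1 7 one_pos (by norm_num) σ) := by
  have hj := eight_mul_add_one_ne_zero σ
  have h10' : ((A₀ 1 0 : ℤ) : ℂ) = 8 := by exact_mod_cast h10
  have h11' : ((A₀ 1 1 : ℤ) : ℂ) = 1 := by exact_mod_cast h11
  rw [SL_slash_apply, ModularGroup.denom_apply, hφ, h10', h11']
  simp only
  rw [P_A0_smul A₀ h00 h01 h10 h11 σ, Q_A0_smul A₀ h00 h01 h10 h11 σ, zpow_neg, zpow_ofNat]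
  field_simp
  ring

/-- **`R|₂A → 0` at every `A ∉ Γ₀(56)`** for `R = (2πi)⁻¹U′ + φ·2(V − U)`, once `R → 0` at `∞`: at the cusps with `8 ∤ c` by Ligozat, at the class of
`1/8` because `R|₂A₀ = R∘β⁻¹/7` (`U`, `V` are `W₇`-invariant and `φ|W₇ = φ`). [cite: DiamondShurman2005, §1.2, §3.8] -/
theorem isZeroAtImInfty_slash_R (h0 : IsZeroAtImInfty (fun σ : ℍ ↦ (2 * π * I)⁻¹
      * deriv (etaQuotient 56 (expFn [(2, -1), (4, 3), (8, -2), (14, -1), (28, 3), (56, -2)]) ∘ ofComplex) σ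
      + φ σ * (2 * (etaQuotient 56 (expFn [(1, -1), (2, 2), (4, 1), (7, -1), (8, -2), (14, 2), (28, 1), (56, -2)]) σ
        - etaQuotient 56 (expFn [(2, -1), (4, 3), (8, -2), (14, -1), (28, 3), (56, -2)]) σ))))
    (A : SL(2, ℤ)) (hA : A ∉ Gamma0 56) :
    IsZeroAtImInfty ((fun σ : ℍ ↦ (2 * π * I)⁻¹
      * deriv (etaQuotient 56 (expFn [(2, -1), (4, 3), (8, -2), (14, -1), (28, 3), (56, -2)]) ∘ ofComplex) σ
      + φ σ * (2 * (etaQuotient 56 (expFn [(1, -1), (2, 2), (4, 1), (7, -1), (8, -2), (14, 2), (28, 1), (56, -2)]) σ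
        - etaQuotient 56 (expFn [(2, -1), (4, 3), (8, -2), (14, -1), (28, 3), (56, -2)]) σ))) ∣[(2 : ℤ)] A) := by
  set U : ℍ → ℂ := etaQuotient 56 (expFn [(2, -1), (4, 3), (8, -2), (14, -1), (28, 3), (56, -2)]) with hU
  set V : ℍ → ℂ := etaQuotient 56 (expFn [(1, -1), (2, 2), (4, 1), (7, -1), (8, -2), (14, 2), (28, 1), (56, -2)]) with hV
  have hUmd : MDifferentiable 𝓘(ℂ) 𝓘(ℂ) U := mdifferentiable_etaQuotient 56 _
  have hyinv : ∀ γ : SL(2, ℤ), γ ∈ Gamma0 56 → ∀ τ : ℍ, (fun σ ↦ 2 * (V σ - U σ)) (γ • τ) = (fun σ ↦ 2 * (V σ - U σ)) τ :=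
    fun γ hγ τ ↦ by simp only [hU, hV, U_smul γ hγ τ, V_smul γ hγ τ]
  by_cases h8 : (8 : ℤ) ∣ A 1 0
  · refine isZeroAtImInfty_slash_of_cusp_eighth _ 2 (fun γ hγ ↦ slash_eq_self_of_mem φ U _ hUmd U_smul hyinv hγ) ?_ h8 hA
    intro A₀ h00 h01 h10 h11
    have hfun : ((fun σ : ℍ ↦ (2 * π * I)⁻¹ * deriv (U ∘ ofComplex) σ + φ σ * (2 * (V σ - U σ))) ∣[(2 : ℤ)] A₀)
        = fun σ : ℍ ↦ (1 / 7 : ℂ) * ((2 * π * I)⁻¹ * deriv (U ∘ ofComplex) (affPt 1 1 7 one_pos (by norm_num) σ)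
          + φ (affPt 1 1 7 one_pos (by norm_num) σ) * (2 * (V (affPt 1 1 7 one_pos (by norm_num) σ) - U (affPt 1 1 7 one_pos (by norm_num) σ)))) := by
      funext σ
      rw [slash_two_apply_of φ _ hUmd A₀ σ, phi_slash_A0 φ hφ A₀ h00 h01 h10 h11 σ,
        show (fun s : ℍ ↦ U (A₀ • s)) = fun s : ℍ ↦ U (affPt 1 1 7 one_pos (by norm_num) s) from funext (U_A0_smul A₀ h00 h01 h10 h11),
        deriv_comp_affPt hUmd σ, hU, hV, U_A0_smul A₀ h00 h01 h10 h11 σ, V_A0_smul A₀ h00 h01 h10 h11 σ]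
      ring
    rw [hfun]
    have h1 := (isZeroAtImInfty_comp_affPt h0).const_mul (1 / 7 : ℂ)
    rw [mul_zero] at h1
    exact h1
  · exact isZeroAtImInfty_slash_of_isBoundedAtImInfty φ U _ hUmd A (isBoundedAtImInfty_U_smul h8)
      ((((isBoundedAtImInfty_V_smul h8).sub (isBoundedAtImInfty_U_smul h8)).const_mul_left 2).congr_left fun σ ↦ by
        simp only [hU, hV])

/-- **(I2a)₅₆ₐ: `U′ = −2πiφ·2(V − U)` on `ℍ`** for `φ = P − Q` (`x′ = −2πiφ·2y` on `56a1`). [cite: Ligozat1975, Ch. 4] -/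
theorem deriv_U56_identity (τ : ℍ) :
    deriv (etaQuotient 56 (expFn [(2, -1), (4, 3), (8, -2), (14, -1), (28, 3), (56, -2)]) ∘ ofComplex) τ
      = -(2 * π * I * φ τ) * (2 * (etaQuotient 56 (expFn [(1, -1), (2, 2), (4, 1), (7, -1), (8, -2), (14, 2), (28, 1), (56, -2)]) τ
        - etaQuotient 56 (expFn [(2, -1), (4, 3), (8, -2), (14, -1), (28, 3), (56, -2)]) τ)) := by
  have hT1 : Tendsto (fun τ : ℍ ↦ ((2 * π * I)⁻¹
      * deriv (etaQuotient 56 (expFn [(2, -1), (4, 3), (8, -2), (14, -1), (28, 3), (56, -2)]) ∘ ofComplex) τ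
      + φ τ * (2 * (etaQuotient 56 (expFn [(1, -1), (2, 2), (4, 1), (7, -1), (8, -2), (14, 2), (28, 1), (56, -2)]) τ
        - etaQuotient 56 (expFn [(2, -1), (4, 3), (8, -2), (14, -1), (28, 3), (56, -2)]) τ)))
      / Function.Periodic.qParam 1 (τ : ℂ) ^ 10) atImInfty (𝓝 0) := by
    simpa only [hφ] using EtaLimitDerivFiftySix.tendsto_T1
  have hq : Tendsto (fun τ : ℍ ↦ Function.Periodic.qParam 1 (τ : ℂ) ^ 10) atImInfty (𝓝 0) := by
    simpa only [zpow_natCast] using tendsto_qParam_zpow_atImInfty (m := ((10 : ℕ) : ℤ)) (by norm_num)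
  have h0 := hT1.mul hq
  rw [zero_mul] at h0
  refine deriv_eq_of_tendsto_pow_of φ 10 (by norm_num) (fun S hS ↦ cuspForm_two_fiftySix_eq_zero_of_tendsto S hS) _
    (fun σ ↦ 2 * (etaQuotient 56 (expFn [(1, -1), (2, 2), (4, 1), (7, -1), (8, -2), (14, 2), (28, 1), (56, -2)]) σ
      - etaQuotient 56 (expFn [(2, -1), (4, 3), (8, -2), (14, -1), (28, 3), (56, -2)]) σ))
    (mdifferentiable_etaQuotient 56 _) (((mdifferentiable_etaQuotient 56 _).sub (mdifferentiable_etaQuotient 56 _)).const_smul (2 : ℂ))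
    U_smul (fun γ hγ τ ↦ by simp only [U_smul γ hγ τ, V_smul γ hγ τ])
    (isZeroAtImInfty_slash_R φ hφ (h0.congr fun τ ↦ div_mul_cancel₀ _ (pow_ne_zero _ (Complex.exp_ne_zero _)))) hT1 τ

/-! ## §3 (S2)₅₆ₐ: `Λ(P − Q) ⊆ Λ(−4, −8)` -/

/-- **(S2)₅₆ₐ**: the period lattice of `φ = P − Q` lies in the lattice of the Weierstrass pair with `g₂ = −4 = c₄/12`, `g₃ = −8 = c₆/216` of
`56a1 = [0, 0, 0, 1, 2]` (analytic bridge on `X = U − 1`: `(X′)² = (2πiφ)²(4X³ + 4X + 8)`). [cite: CremonaAlgorithms1997, §2.10, Table 1 (56a1)] -/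
theorem periodLatticeLe_fiftySixA :
    ∃ L₁ : PeriodPair, L₁.g₂ = -4 ∧ L₁.g₃ = -8 ∧ ∀ z ∈ periodLattice φ, z ∈ L₁.lattice := by
  obtain ⟨L₁, hg2, hg3⟩ := PeriodPair.uniformization_holds (-4) (-8) (by norm_num)
  -- `φ ≠ 0`: `(P − Q)/q → 1` at `i∞`
  have hne : φ ≠ 0 := by
    intro h
    have hP := tendsto_etaQuotient_div_qParam_zpow 56 (expFn [(2, -1), (4, 3), (14, 3), (28, -1)]) 1 (by decide)
    have hQ := tendsto_etaQuotient_div_qParam_zpow 56 (expFn [(2, 3), (4, -1), (14, -1), (28, 3)]) 3 (by decide)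
    have hq := tendsto_qParam_zpow_atImInfty (m := 2) (by norm_num)
    have hlim : Tendsto (fun τ : ℍ ↦ φ τ / Function.Periodic.qParam 1 (τ : ℂ) ^ (1 : ℤ)) atImInfty (𝓝 (1 - 1 * 0)) := by
      refine (hP.sub (hQ.mul hq)).congr fun τ ↦ ?_
      have hqτ : Function.Periodic.qParam 1 (τ : ℂ) ≠ 0 := Complex.exp_ne_zero _
      rw [hφ]
      simp only [zpow_ofNat, pow_one]
      field_simp
    rw [h] at hlim
    simp only [CuspForm.zero_apply, zero_div, mul_zero, sub_zero] at hlim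
    exact zero_ne_one (tendsto_nhds_unique tendsto_const_nhds hlim)
  have hmd : MDifferentiable 𝓘(ℂ) 𝓘(ℂ) (fun τ : ℍ ↦ etaQuotient 56 (expFn [(2, -1), (4, 3), (8, -2), (14, -1), (28, 3), (56, -2)]) τ - 1) :=
    (mdifferentiable_etaQuotient 56 _).sub mdifferentiable_const
  refine ⟨L₁, hg2, hg3, periodLattice_le_of_deriv_sq φ hne L₁ _ hmd
    (fun γ τ ↦ by simp only [U_smul γ γ.2 τ]) ?_ (by rw [hg2, hg3]; exact exists_X_nondegenerate)⟩
  intro τ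
  have hderiv : deriv ((fun σ : ℍ ↦ etaQuotient 56 (expFn [(2, -1), (4, 3), (8, -2), (14, -1), (28, 3), (56, -2)]) σ - 1) ∘ ofComplex) τ
      = deriv (etaQuotient 56 (expFn [(2, -1), (4, 3), (8, -2), (14, -1), (28, 3), (56, -2)]) ∘ ofComplex) τ := by
    rw [show ((fun σ : ℍ ↦ etaQuotient 56 (expFn [(2, -1), (4, 3), (8, -2), (14, -1), (28, 3), (56, -2)]) σ - 1) ∘ ofComplex)
      = fun z ↦ (etaQuotient 56 (expFn [(2, -1), (4, 3), (8, -2), (14, -1), (28, 3), (56, -2)]) ∘ ofComplex) z - 1 from rfl, deriv_sub_const]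
  rw [hderiv, deriv_U56_identity φ hφ τ, hg2, hg3]
  linear_combination 4 * (2 * π * I * φ τ) ^ 2 * cubic56 τ

end Phi

end Summit.BirchSwinnertonDyer.BirchSwinnertonDyer.Theorems.ManinLocalTwoThree.EtaIdentitiesFiftySix

end
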